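import Summits.QuantumFields.YangMills.Theorems.FradkinShenkerFlowFiniteSusceptibilityWeakCouplingSpeciesParity
import HarnessLib

/-!
# The even split of the crux, curried (item stmt-QuantumFields-9442)

Support file for item stmt-QuantumFields-9442 (route `FradkinShenkerFlow` of `YangMills`), crux
`Summit.QuantumFields.YangMills.Theses.FradkinShenkerFlow.FiniteSusceptibilityWeakCoupling`, line `purity-rate-split` (lead c21).
The crux-strategist (generation 2) FILED the two registered stubs of the line as crux items on the route —
stmt-QuantumFields-18060 `NoEvenLongRangeOrder` (purity half: at weak coupling no reflection-even gauge-invariant local observable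
has long-range order along the time axis, uniformly in the odd tori) and stmt-QuantumFields-18061 `DecorrelationForcesSummability`
(rate half: uniform decorrelation forces the susceptibility clause) — and asked for the CURRIED glue by name, so that the route's formal
split can cite it (`--glue-by …finiteSusceptibilityWeakCoupling_of_even_subs`). This file is that glue, one line each from the landed
tree certificate `SpeciesParity.finiteSusceptibilityWeakCoupling_iff_even_subs` (p144906):

* `finiteSusceptibilityWeakCoupling_of_even_subs : NoEvenLongRangeOrder → DecorrelationForcesSummability → crux`;
* `EvenSplit.noEvenLongRangeOrder_of_crux` (the purity child is necessary; the rate child is the landed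
  `decorrelationForcesSummability_of_finiteSusceptibility` of `…Split.lean`, and the lossless form is the landed iff itself);
* the registered stub `stub_cruxOfEvenSubs` (signature verbatim).

The two hypotheses are written out verbatim as the children's signatures (items 18060 / 18061); nothing here is a named fact;
every compact `G`. [folklore]
-/

noncomputable section

open MeasureTheory ProbabilityTheory Finset
open Literature.MathematicalPhysics.QuantumFieldTheory hiding Site ZdEdge
open Literature.MathematicalPhysics.QuantumLattice
open Literature.Probability.LatticeModels hiding configShift configShift_apply

namespace Summit.QuantumFields.YangMills.Theorems.FiniteSusceptibilityWeakCoupling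

/-- **`NoEvenLongRangeOrder → DecorrelationForcesSummability → FiniteSusceptibilityWeakCoupling`** (the curried even split of the
crux of item stmt-QuantumFields-9442 into its two children, items stmt-QuantumFields-18060 and stmt-QuantumFields-18061; direction `←`
of the landed `SpeciesParity.finiteSusceptibilityWeakCoupling_iff_even_subs`). [folklore] -/
theorem finiteSusceptibilityWeakCoupling_of_even_subs
    (h₀ : ∀ (G : Type) [Group G] [TopologicalSpace G] [IsTopologicalGroup G] [CompactSpace G] [MeasurableSpace G]
      [BorelSpace G], IsCompactSimpleLieGroup G → ∀ r : LatticeRep G, ∃ β₀ : ℝ, ∀ β : ℝ, β₀ ≤ β →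
      ∀ A : YMSpecies G, (∀ V, A.F (cfgReflect V) = A.F V) → ∀ ε : ℝ, 0 < ε → ∃ j₀ : ℕ, ∀ S j : ℕ,
        j₀ ≤ j → j ≤ S → |latticeConnectedCorr r.ρ β (2 * S + 1) A.F A.F j| ≤ ε)
    (h₁ : ∀ (G : Type) [Group G] [TopologicalSpace G] [IsTopologicalGroup G] [CompactSpace G] [MeasurableSpace G]
      [BorelSpace G], IsCompactSimpleLieGroup G → ∀ r : LatticeRep G, ∃ β₀ : ℝ, ∀ β : ℝ, β₀ ≤ β →
      (∀ A B : YMSpecies G, ∀ ε : ℝ, 0 < ε → ∃ n₀ : ℕ, ∀ S n : ℕ, n₀ ≤ n → n ≤ S →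
        |latticeConnectedCorr r.ρ β (2 * S + 1) A.F B.F n| ≤ ε) →
      ∀ A B : YMSpecies G, ∃ χ : ℝ, ∀ S : ℕ,
        ∑ x ∈ box 4 S, |cov[fun U => A.F (torusLift (2 * S + 1) U),
          fun U => B.F (configShift (-x) (torusLift (2 * S + 1) U));
          wilsonMeasure (d := 4) (L := 2 * S + 1) r.ρ β]| ≤ χ) :
    Summit.QuantumFields.YangMills.Theses.FradkinShenkerFlow.FiniteSusceptibilityWeakCoupling :=
  SpeciesParity.finiteSusceptibilityWeakCoupling_iff_even_subs.2 ⟨h₀, h₁⟩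

namespace EvenSplit

/-- **The purity child is necessary**: `FiniteSusceptibilityWeakCoupling → NoEvenLongRangeOrder` (item stmt-QuantumFields-18060's
signature; direction `→` of the landed iff, first component). [folklore] -/
theorem noEvenLongRangeOrder_of_crux
    (h : Summit.QuantumFields.YangMills.Theses.FradkinShenkerFlow.FiniteSusceptibilityWeakCoupling) :
    ∀ (G : Type) [Group G] [TopologicalSpace G] [IsTopologicalGroup G] [CompactSpace G] [MeasurableSpace G]
      [BorelSpace G], IsCompactSimpleLieGroup G → ∀ r : LatticeRep G, ∃ β₀ : ℝ, ∀ β : ℝ, β₀ ≤ β →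
      ∀ A : YMSpecies G, (∀ V, A.F (cfgReflect V) = A.F V) → ∀ ε : ℝ, 0 < ε → ∃ j₀ : ℕ, ∀ S j : ℕ,
        j₀ ≤ j → j ≤ S → |latticeConnectedCorr r.ρ β (2 * S + 1) A.F A.F j| ≤ ε :=
  (SpeciesParity.finiteSusceptibilityWeakCoupling_iff_even_subs.1 h).1

end EvenSplit

/-- **Registered sub-goal `stub_cruxOfEvenSubs`** of item stmt-QuantumFields-9442 (signature verbatim, fully qualified): the two
children items stmt-QuantumFields-18060 `NoEvenLongRangeOrder` and stmt-QuantumFields-18061 `DecorrelationForcesSummability` together give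
the crux `FiniteSusceptibilityWeakCoupling` — the curried even split (`finiteSusceptibilityWeakCoupling_of_even_subs`). [folklore] -/
theorem stub_cruxOfEvenSubs : (∀ (G : Type) [Group G] [TopologicalSpace G] [IsTopologicalGroup G] [CompactSpace G] [MeasurableSpace G] [BorelSpace G], Literature.MathematicalPhysics.QuantumFieldTheory.IsCompactSimpleLieGroup G → ∀ r : Literature.MathematicalPhysics.QuantumFieldTheory.LatticeRep G, ∃ β₀ : ℝ, ∀ β : ℝ, β₀ ≤ β → ∀ A : Literature.MathematicalPhysics.QuantumFieldTheory.YMSpecies G, (∀ V, A.F (Literature.MathematicalPhysics.QuantumFieldTheory.cfgReflect V) = A.F V) → ∀ ε : ℝ, 0 < ε → ∃ j₀ : ℕ, ∀ S j : ℕ, j₀ ≤ j → j ≤ S → |Literature.MathematicalPhysics.QuantumFieldTheory.latticeConnectedCorr r.ρ β (2 * S + 1) A.F A.F j| ≤ ε) → (∀ (G : Type) [Group G] [TopologicalSpace G] [IsTopologicalGroup G] [CompactSpace G] [MeasurableSpace G] [BorelSpace G], Literature.MathematicalPhysics.QuantumFieldTheory.IsCompactSimpleLieGroup G → ∀ r :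 Literature.MathematicalPhysics.QuantumFieldTheory.LatticeRep G, ∃ β₀ : ℝ, ∀ β : ℝ, β₀ ≤ β → (∀ A B : Literature.MathematicalPhysics.QuantumFieldTheory.YMSpecies G, ∀ ε : ℝ, 0 < ε → ∃ n₀ : ℕ, ∀ S n : ℕ, n₀ ≤ n → n ≤ S → |Literature.MathematicalPhysics.QuantumFieldTheory.latticeConnectedCorr r.ρ β (2 * S + 1) A.F B.F n| ≤ ε) → ∀ A B : Literature.MathematicalPhysics.QuantumFieldTheory.YMSpecies G, ∃ χ : ℝ, ∀ S : ℕ, ∑ x ∈ Literature.Probability.LatticeModels.box 4 S, |ProbabilityTheory.covariance (fun U => A.F (Literature.MathematicalPhysics.QuantumLattice.torusLift (2 * S + 1) U)) (fun U => B.F (Literature.MathematicalPhysics.QuantumLattice.configShift (-x) (Literature.MathematicalPhysics.QuantumLattice.torusLift (2 * S + 1) U))) (Literature.MathematicalPhysics.QuantumFieldTheory.wilsonMeasure (d := 4) (L := 2 * S + 1) r.ρ β)| ≤ χ) → Summit.QuantumFields.YangMills.Theses.FradkinShenkerFlow.FiniteSusceptibilityWeakCoupling :=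
  finiteSusceptibilityWeakCoupling_of_even_subs

end Summit.QuantumFields.YangMills.Theorems.FiniteSusceptibilityWeakCoupling

end
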